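import Literature.ModelTheory.ExponentialFields.OMinimalIntervals
import Literature.ModelTheory.ExponentialFields.OMinimalDefinability
import Mathlib.Order.Monotone.Basic
import HarnessLib

/-!
# The monotonicity theorem for o-minimal structures, I: the three lemmas

Topic `Literature/ModelTheory/ExponentialFields`.  This file and `OMinimalMonotonicity.lean`
formalize the **monotonicity theorem** of Pillay–Steinhorn (*Definable sets in ordered structures
I*, Trans. AMS 295 (1986), Thm. 4.2) in the form and with the proof of van den Dries, *Tame
topology and o-minimal structures* (1998), Ch. 3, (1.2)–(1.5): a definable unary function in an
o-minimal structure is, off a finite set, piecewise constant or strictly monotone and continuous.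
Here are the ingredients of Ch. 3, (1.3)–(1.5) that do not need the "difficult case" of Lemma 2:

* `exists_gt_rel_apply_or` / `exists_lt_rel_apply_or`: at each point of an interval on which `f`
  is injective, `f` is, immediately to the right (left) of `x`, either above or below `f x` —
  the dichotomies behind the formulas `Φ±±` of the proof of Lemma 2 (Ch. 3, (1.5));
* `exists_Ioo_const_or_injOn` — **Lemma 1** (Ch. 3, (1.3)/(1.5)): on a subinterval `f` is
  constant or injective;
* `exists_Ioo_image_eq_Ioo_of_strictMonoOn` / `_of_strictAntiOn` and
  `ordCtsAt_of_image_eq_Ioo` / `_anti` — **Lemma 3** (Ch. 3, (1.3)/(1.5)): a strictly monotone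
  definable function maps some subinterval onto an interval, and is therefore continuous there
  (continuity is expressed intrinsically, by the order: `y₁ < f x < y₂ ⇒ y₁ < f < y₂` on an open
  interval around `x`; the topological reading is in `OMinimalMonotonicity.lean`);
* `rel_apply_of_local` — the patching argument of Ch. 3, (1.4), Cases 1–3, and the "easy case"
  `Φ₋₊` of Lemma 2, in one statement: if at every point of `(c, d)` the values of `f` are
  `r`-below `f x` just left of `x` and `r`-above just right of `x`, for a transitive definable
  relation `r` (`=`, `<` or `>`), then `x < y ⇒ r (f x) (f y)` on all of `(c, d)` (proved with
  the definable greatest lower bound of the set of counterexamples, van den Dries's `sup`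
  argument).

Setting: an `L`-structure `M` which is a dense linear order without endpoints (van den Dries,
Ch. 1, (3.1)–(3.2)), o-minimal in the sense of `FirstOrder.Language.IsOMinimal`
(`ModelTheoryPreds.lean`; Pillay–Steinhorn 1986, Def. 1.1), with `<` definable (axiom (O1);
automatic in an ordered structure, `definable_lt_of_orderedStructure`) and `f : M → M` with
definable graph.  Nothing here is a named fact.

## References

* [Dries1998] L. van den Dries, *Tame topology and o-minimal structures*, CUP 1998, Ch. 3, §1,
  (1.1)–(1.5).
* [PillaySteinhorn1986] A. Pillay, C. Steinhorn, *Definable sets in ordered structures I*,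
  Trans. AMS 295 (1986) 565–592, §4.
-/

open Set FirstOrder FirstOrder.Language

namespace Literature.ModelTheory.ExponentialFields

universe u v

variable {L : Language.{u, v}} {M : Type*} [L.Structure M] [LinearOrder M]
  [DenselyOrdered M] {f : M → M}

/-! ### Germs of the comparison with `f x` -/

/-- **Right dichotomy** (van den Dries 1998, Ch. 3, (1.5), proof of Lemma 2: "the interval
`(x, b)` breaks up similarly"): if `f` is injective on `(a, b)` and `r` is a definable relation
which is total on distinct values, then immediately to the right of any `x ∈ (a, b)` either
`r (f x) (f y)` throughout or `r (f y) (f x)` throughout. [cite: Dries1998, Ch. 3 (1.5)] -/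
theorem exists_gt_rel_apply_or [NoMaxOrder M] (hO : L.IsOMinimal M) {r : M → M → Prop}
    (hr : (univ : Set M).Definable L {v : Fin 2 → M | r (v 0) (v 1)})
    (htot : ∀ p q, p ≠ q → r p q ∨ r q p)
    (hf : (univ : Set M).Definable L {v : Fin 2 → M | v 1 = f (v 0)})
    {a b x : M} (hx : x ∈ Ioo a b) (hinj : InjOn f (Ioo a b)) :
    ∃ c, x < c ∧ c ≤ b ∧
      ((∀ y ∈ Ioo x c, r (f x) (f y)) ∨ (∀ y ∈ Ioo x c, r (f y) (f x))) := by
  have h₁ : IsFiniteUnionOfIntervals {y | r (f x) (f y)} :=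
    isFiniteUnionOfIntervals_setOf hO
      (definable_setOf_rel hr (definableFun_const' _ (f x))
        (definableFun_apply hf (definableFun_proj 0)))
  have h₂ : IsFiniteUnionOfIntervals {y | r (f y) (f x)} :=
    isFiniteUnionOfIntervals_setOf hO
      (definable_setOf_rel hr (definableFun_apply hf (definableFun_proj 0))
        (definableFun_const' _ (f x)))
  obtain ⟨c₁, hxc₁, hc₁⟩ := h₁.exists_Ioo_subset_or_disjoint_right x
  obtain ⟨c₂, hxc₂, hc₂⟩ := h₂.exists_Ioo_subset_or_disjoint_right x
  refine ⟨min (min c₁ c₂) b, lt_min (lt_min hxc₁ hxc₂) hx.2, min_le_right _ _, ?_⟩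
  have hsub₁ : Ioo x (min (min c₁ c₂) b) ⊆ Ioo x c₁ := fun y hy =>
    ⟨hy.1, lt_of_lt_of_le hy.2 ((min_le_left _ _).trans (min_le_left _ _))⟩
  have hsub₂ : Ioo x (min (min c₁ c₂) b) ⊆ Ioo x c₂ := fun y hy =>
    ⟨hy.1, lt_of_lt_of_le hy.2 ((min_le_left _ _).trans (min_le_right _ _))⟩
  rcases hc₁ with hc₁ | hc₁
  · exact Or.inl fun y hy => hc₁ (hsub₁ hy)
  rcases hc₂ with hc₂ | hc₂
  · exact Or.inr fun y hy => hc₂ (hsub₂ hy)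
  -- both germs empty: impossible at any point of the (non-empty) interval
  exfalso
  obtain ⟨y, hy⟩ := exists_between (lt_min (lt_min hxc₁ hxc₂) hx.2)
  have hyI : y ∈ Ioo a b := ⟨hx.1.trans hy.1, lt_of_lt_of_le hy.2 (min_le_right _ _)⟩
  have hne : f x ≠ f y := fun h => (ne_of_lt hy.1) (hinj hx hyI h)
  rcases htot _ _ hne with h | h
  · exact disjoint_left.1 hc₁ (hsub₁ hy) h
  · exact disjoint_left.1 hc₂ (hsub₂ hy) h

/-- **Left dichotomy** (van den Dries 1998, Ch. 3, (1.5), proof of Lemma 2: "`(a, x)` is a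
disjoint union of two subsets … so one of the parts contains an interval `(c, x)`"): the mirror
image of `exists_gt_rel_apply_or`. [cite: Dries1998, Ch. 3 (1.5)] -/
theorem exists_lt_rel_apply_or [NoMinOrder M] (hO : L.IsOMinimal M) {r : M → M → Prop}
    (hr : (univ : Set M).Definable L {v : Fin 2 → M | r (v 0) (v 1)})
    (htot : ∀ p q, p ≠ q → r p q ∨ r q p)
    (hf : (univ : Set M).Definable L {v : Fin 2 → M | v 1 = f (v 0)})
    {a b x : M} (hx : x ∈ Ioo a b) (hinj : InjOn f (Ioo a b)) :
    ∃ c, c < x ∧ a ≤ c ∧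
      ((∀ y ∈ Ioo c x, r (f x) (f y)) ∨ (∀ y ∈ Ioo c x, r (f y) (f x))) := by
  have h₁ : IsFiniteUnionOfIntervals {y | r (f x) (f y)} :=
    isFiniteUnionOfIntervals_setOf hO
      (definable_setOf_rel hr (definableFun_const' _ (f x))
        (definableFun_apply hf (definableFun_proj 0)))
  have h₂ : IsFiniteUnionOfIntervals {y | r (f y) (f x)} :=
    isFiniteUnionOfIntervals_setOf hO
      (definable_setOf_rel hr (definableFun_apply hf (definableFun_proj 0))
        (definableFun_const' _ (f x)))
  obtain ⟨c₁, hxc₁, hc₁⟩ := h₁.exists_Ioo_subset_or_disjoint_left x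
  obtain ⟨c₂, hxc₂, hc₂⟩ := h₂.exists_Ioo_subset_or_disjoint_left x
  refine ⟨max (max c₁ c₂) a, max_lt (max_lt hxc₁ hxc₂) hx.1, le_max_right _ _, ?_⟩
  have hsub₁ : Ioo (max (max c₁ c₂) a) x ⊆ Ioo c₁ x := fun y hy =>
    ⟨lt_of_le_of_lt ((le_max_left _ _).trans (le_max_left _ _)) hy.1, hy.2⟩
  have hsub₂ : Ioo (max (max c₁ c₂) a) x ⊆ Ioo c₂ x := fun y hy =>
    ⟨lt_of_le_of_lt ((le_max_right _ _).trans (le_max_left _ _)) hy.1, hy.2⟩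
  rcases hc₁ with hc₁ | hc₁
  · exact Or.inl fun y hy => hc₁ (hsub₁ hy)
  rcases hc₂ with hc₂ | hc₂
  · exact Or.inr fun y hy => hc₂ (hsub₂ hy)
  exfalso
  obtain ⟨y, hy⟩ := exists_between (max_lt (max_lt hxc₁ hxc₂) hx.1)
  have hyI : y ∈ Ioo a b := ⟨lt_of_le_of_lt (le_max_right _ _) hy.1, hy.2.trans hx.2⟩
  have hne : f x ≠ f y := fun h => (ne_of_gt hy.2) (hinj hx hyI h)
  rcases htot _ _ hne with h | h
  · exact disjoint_left.1 hc₁ (hsub₁ hy) h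
  · exact disjoint_left.1 hc₂ (hsub₂ hy) h

/-! ### Lemma 1: constant or injective on a subinterval -/

/-- **Lemma 1** (van den Dries 1998, Ch. 3, (1.3), proved in (1.5)): a definable function is,
on some subinterval of any interval `(a, b)`, either constant or injective.  (If some fibre is
infinite it contains an interval; otherwise the image is infinite, contains an interval `J`, and
the set of least points of the fibres over `J` is an infinite definable set on which `f` is
injective.) [cite: Dries1998, Ch. 3 (1.3) Lemma 1] -/
theorem exists_Ioo_const_or_injOn [NoMinOrder M] [NoMaxOrder M] (hO : L.IsOMinimal M)
    (hlt : (univ : Set M).Definable L {v : Fin 2 → M | v 0 < v 1})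
    (hf : (univ : Set M).Definable L {v : Fin 2 → M | v 1 = f (v 0)})
    {a b : M} (hab : a < b) :
    ∃ a' b', a ≤ a' ∧ a' < b' ∧ b' ≤ b ∧
      ((∀ x ∈ Ioo a' b', ∀ y ∈ Ioo a' b', f x = f y) ∨ InjOn f (Ioo a' b')) := by
  classical
  -- fibres inside `(a, b)`
  have hfib : ∀ y, IsFiniteUnionOfIntervals {x | a < x ∧ x < b ∧ f x = y} := fun y =>
    isFiniteUnionOfIntervals_setOf hO
      (definable_setOf_and
        (definable_setOf_lt hlt (definableFun_const' _ a) (definableFun_proj 0))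
        (definable_setOf_and
          (definable_setOf_lt hlt (definableFun_proj 0) (definableFun_const' _ b))
          (definable_setOf_eq' (definableFun_apply hf (definableFun_proj 0))
            (definableFun_const' _ y))))
  by_cases hinf : ∃ y, ({x | a < x ∧ x < b ∧ f x = y} : Set M).Infinite
  · -- an infinite fibre contains an interval, on which `f` is constant
    obtain ⟨y, hy⟩ := hinf
    obtain ⟨a', b', hab', hsub⟩ := (hfib y).exists_Ioo_subset_of_infinite hy
    have hI : Ioo a' b' ⊆ Ioo a b := fun x hx => ⟨(hsub hx).1, (hsub hx).2.1⟩
    obtain ⟨haa', hbb'⟩ := (Ioo_subset_Ioo_iff hab').1 hI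
    exact ⟨a', b', haa', hab', hbb', Or.inl fun x hx x' hx' =>
      (hsub hx).2.2.trans (hsub hx').2.2.symm⟩
  · have hfin : ∀ y, ({x | a < x ∧ x < b ∧ f x = y} : Set M).Finite := fun y =>
      not_infinite.1 fun h => hinf ⟨y, h⟩
    -- the image of `(a, b)` is definable and infinite, hence contains an interval `(p, q)`
    have hT : IsFiniteUnionOfIntervals {y | ∃ x, a < x ∧ x < b ∧ f x = y} := by
      apply isFiniteUnionOfIntervals_setOf hO
      apply definable_setOf_exists
      exact definable_setOf_and
        (definable_setOf_lt hlt (definableFun_const' _ a) (definableFun_proj _))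
        (definable_setOf_and
          (definable_setOf_lt hlt (definableFun_proj _) (definableFun_const' _ b))
          (definable_setOf_eq' (definableFun_apply hf (definableFun_proj _))
            (definableFun_proj _)))
    have hTinf : ({y | ∃ x, a < x ∧ x < b ∧ f x = y} : Set M).Infinite := by
      intro hTfin
      have hcov : Ioo a b ⊆ ⋃ y ∈ {y | ∃ x, a < x ∧ x < b ∧ f x = y},
          {x | a < x ∧ x < b ∧ f x = y} := fun x hx =>
        mem_biUnion (show f x ∈ {y | ∃ x, a < x ∧ x < b ∧ f x = y} from ⟨x, hx.1, hx.2, rfl⟩)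
          ⟨hx.1, hx.2, rfl⟩
      exact (Ioo_infinite hab) ((hTfin.biUnion fun y _ => hfin y).subset hcov)
    obtain ⟨p, q, hpq, hJ⟩ := hT.exists_Ioo_subset_of_infinite hTinf
    -- least points of the fibres over `(p, q)`
    set G : Set M := {x | a < x ∧ x < b ∧ (p < f x ∧ f x < q) ∧
      ∀ x', a < x' → x' < x → ¬ f x' = f x} with hG
    have hGdef : IsFiniteUnionOfIntervals G := by
      apply isFiniteUnionOfIntervals_setOf hO
      refine definable_setOf_and
        (definable_setOf_lt hlt (definableFun_const' _ a) (definableFun_proj _)) ?_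
      refine definable_setOf_and
        (definable_setOf_lt hlt (definableFun_proj _) (definableFun_const' _ b)) ?_
      refine definable_setOf_and (definable_setOf_and
        (definable_setOf_lt hlt (definableFun_const' _ p) (definableFun_apply hf
          (definableFun_proj _)))
        (definable_setOf_lt hlt (definableFun_apply hf (definableFun_proj _))
          (definableFun_const' _ q))) ?_
      apply definable_setOf_forall
      refine definable_setOf_imp
        (definable_setOf_lt hlt (definableFun_const' _ a) (definableFun_proj _)) ?_
      refine definable_setOf_imp
        (definable_setOf_lt hlt (definableFun_proj _) (definableFun_proj _)) ?_
      exact definable_setOf_not (definable_setOf_eq'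
        (definableFun_apply hf (definableFun_proj _)) (definableFun_apply hf (definableFun_proj _)))
    -- `G` is infinite: `f` maps it onto `(p, q)`
    have hGinf : G.Infinite := by
      intro hGfin
      apply Ioo_infinite hpq
      refine (hGfin.image f).subset fun y hy => ?_
      have hyT : y ∈ {y | ∃ x, a < x ∧ x < b ∧ f x = y} := hJ hy
      have hne : ({x | a < x ∧ x < b ∧ f x = y} : Set M).Nonempty := by
        obtain ⟨x, hx₁, hx₂, hx₃⟩ := hyT
        exact ⟨x, hx₁, hx₂, hx₃⟩
      set x₀ := (hfin y).toFinset.min' ((hfin y).toFinset_nonempty.2 hne) with hx₀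
      have hx₀mem : x₀ ∈ (hfin y).toFinset := Finset.min'_mem _ _
      have hx₀S : a < x₀ ∧ x₀ < b ∧ f x₀ = y := by
        simpa using (hfin y).mem_toFinset.1 hx₀mem
      refine ⟨x₀, ⟨hx₀S.1, hx₀S.2.1, ?_, fun x' hx'₁ hx'₂ hfx' => ?_⟩, hx₀S.2.2⟩
      · rw [hx₀S.2.2]; exact hy
      · have hx'mem : x' ∈ (hfin y).toFinset :=
          (hfin y).mem_toFinset.2 ⟨hx'₁, hx'₂.trans hx₀S.2.1, hfx'.trans hx₀S.2.2⟩
        exact (not_le.2 hx'₂) (Finset.min'_le _ _ hx'mem)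
    obtain ⟨a', b', hab', hsub⟩ := hGdef.exists_Ioo_subset_of_infinite hGinf
    have hI : Ioo a' b' ⊆ Ioo a b := fun x hx => ⟨(hsub hx).1, (hsub hx).2.1⟩
    obtain ⟨haa', hbb'⟩ := (Ioo_subset_Ioo_iff hab').1 hI
    refine ⟨a', b', haa', hab', hbb', Or.inr fun x₁ hx₁ x₂ hx₂ heq => ?_⟩
    rcases lt_trichotomy x₁ x₂ with h | h | h
    · exact absurd heq ((hsub hx₂).2.2.2 x₁ (hI hx₁).1 h)
    · exact h
    · exact absurd heq.symm ((hsub hx₁).2.2.2 x₂ (hI hx₂).1 h)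

/-! ### Lemma 3: strictly monotone implies continuous on a subinterval -/

/-- **Lemma 3, image half, increasing case** (van den Dries 1998, Ch. 3, (1.5), proof of
Lemma 3: "Since `f(I)` is infinite there is an interval `J ⊆ f(I)`. Take two points `r, s ∈ J` …
and let `c, d` be their preimages … `f` defines an order preserving bijection of `(c, d)` onto
`(r, s)`"). [cite: Dries1998, Ch. 3 (1.5) Lemma 3] -/
theorem exists_Ioo_image_eq_Ioo_of_strictMonoOn [NoMinOrder M] [NoMaxOrder M] (hO : L.IsOMinimal M)
    (hlt : (univ : Set M).Definable L {v : Fin 2 → M | v 0 < v 1})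
    (hf : (univ : Set M).Definable L {v : Fin 2 → M | v 1 = f (v 0)})
    {a b : M} (hab : a < b) (hmono : StrictMonoOn f (Ioo a b)) :
    ∃ c d, a ≤ c ∧ c < d ∧ d ≤ b ∧ f c < f d ∧ f '' Ioo c d = Ioo (f c) (f d) := by
  have hT : IsFiniteUnionOfIntervals {y | ∃ x, a < x ∧ x < b ∧ f x = y} := by
    apply isFiniteUnionOfIntervals_setOf hO
    apply definable_setOf_exists
    exact definable_setOf_and
      (definable_setOf_lt hlt (definableFun_const' _ a) (definableFun_proj _))
      (definable_setOf_and
        (definable_setOf_lt hlt (definableFun_proj _) (definableFun_const' _ b))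
        (definable_setOf_eq' (definableFun_apply hf (definableFun_proj _))
          (definableFun_proj _)))
  have hTeq : ({y | ∃ x, a < x ∧ x < b ∧ f x = y} : Set M) = f '' Ioo a b := by
    ext y; constructor
    · rintro ⟨x, hx₁, hx₂, rfl⟩; exact ⟨x, ⟨hx₁, hx₂⟩, rfl⟩
    · rintro ⟨x, ⟨hx₁, hx₂⟩, rfl⟩; exact ⟨x, hx₁, hx₂, rfl⟩
  have hTinf : ({y | ∃ x, a < x ∧ x < b ∧ f x = y} : Set M).Infinite := by
    rw [hTeq]; exact (Ioo_infinite hab).image hmono.injOn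
  obtain ⟨p, q, hpq, hJ⟩ := hT.exists_Ioo_subset_of_infinite hTinf
  obtain ⟨r₀, hpr₀, hr₀q⟩ := exists_between hpq
  obtain ⟨s₀, hr₀s₀, hs₀q⟩ := exists_between hr₀q
  obtain ⟨c, hc₁, hc₂, hfc⟩ := hJ ⟨hpr₀, hr₀q⟩
  obtain ⟨d, hd₁, hd₂, hfd⟩ := hJ ⟨hpr₀.trans hr₀s₀, hs₀q⟩
  have hcd : c < d := by
    rw [← hmono.lt_iff_lt ⟨hc₁, hc₂⟩ ⟨hd₁, hd₂⟩, hfc, hfd]; exact hr₀s₀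
  refine ⟨c, d, hc₁.le, hcd, hd₂.le, by rw [hfc, hfd]; exact hr₀s₀, ?_⟩
  ext y; constructor
  · rintro ⟨x, hx, rfl⟩
    exact ⟨hmono ⟨hc₁, hc₂⟩ ⟨hc₁.trans hx.1, hx.2.trans hd₂⟩ hx.1,
      hmono ⟨hc₁.trans hx.1, hx.2.trans hd₂⟩ ⟨hd₁, hd₂⟩ hx.2⟩
  · rintro ⟨hy₁, hy₂⟩
    rw [hfc] at hy₁; rw [hfd] at hy₂
    obtain ⟨x, hx₁, hx₂, rfl⟩ := hJ ⟨hpr₀.trans hy₁, hy₂.trans hs₀q⟩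
    refine ⟨x, ⟨?_, ?_⟩, rfl⟩
    · rw [← hmono.lt_iff_lt ⟨hc₁, hc₂⟩ ⟨hx₁, hx₂⟩, hfc]; exact hy₁
    · rw [← hmono.lt_iff_lt ⟨hx₁, hx₂⟩ ⟨hd₁, hd₂⟩, hfd]; exact hy₂

/-- **Lemma 3, image half, decreasing case** (van den Dries 1998, Ch. 3, (1.5), proof of
Lemma 3: "The case that `f` is strictly decreasing goes the same way"). [cite: Dries1998, Ch. 3 (1.5) Lemma 3] -/
theorem exists_Ioo_image_eq_Ioo_of_strictAntiOn [NoMinOrder M] [NoMaxOrder M] (hO : L.IsOMinimal M)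
    (hlt : (univ : Set M).Definable L {v : Fin 2 → M | v 0 < v 1})
    (hf : (univ : Set M).Definable L {v : Fin 2 → M | v 1 = f (v 0)})
    {a b : M} (hab : a < b) (hanti : StrictAntiOn f (Ioo a b)) :
    ∃ c d, a ≤ c ∧ c < d ∧ d ≤ b ∧ f d < f c ∧ f '' Ioo c d = Ioo (f d) (f c) := by
  have hT : IsFiniteUnionOfIntervals {y | ∃ x, a < x ∧ x < b ∧ f x = y} := by
    apply isFiniteUnionOfIntervals_setOf hO
    apply definable_setOf_exists
    exact definable_setOf_and
      (definable_setOf_lt hlt (definableFun_const' _ a) (definableFun_proj _))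
      (definable_setOf_and
        (definable_setOf_lt hlt (definableFun_proj _) (definableFun_const' _ b))
        (definable_setOf_eq' (definableFun_apply hf (definableFun_proj _))
          (definableFun_proj _)))
  have hTeq : ({y | ∃ x, a < x ∧ x < b ∧ f x = y} : Set M) = f '' Ioo a b := by
    ext y; constructor
    · rintro ⟨x, hx₁, hx₂, rfl⟩; exact ⟨x, ⟨hx₁, hx₂⟩, rfl⟩
    · rintro ⟨x, ⟨hx₁, hx₂⟩, rfl⟩; exact ⟨x, hx₁, hx₂, rfl⟩
  have hTinf : ({y | ∃ x, a < x ∧ x < b ∧ f x = y} : Set M).Infinite := by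
    rw [hTeq]; exact (Ioo_infinite hab).image hanti.injOn
  obtain ⟨p, q, hpq, hJ⟩ := hT.exists_Ioo_subset_of_infinite hTinf
  obtain ⟨r₀, hpr₀, hr₀q⟩ := exists_between hpq
  obtain ⟨s₀, hr₀s₀, hs₀q⟩ := exists_between hr₀q
  -- `c` is the preimage of the larger value `s₀`, `d` that of `r₀`
  obtain ⟨c, hc₁, hc₂, hfc⟩ := hJ ⟨hpr₀.trans hr₀s₀, hs₀q⟩
  obtain ⟨d, hd₁, hd₂, hfd⟩ := hJ ⟨hpr₀, hr₀q⟩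
  have hcd : c < d := by
    rw [← hanti.lt_iff_gt ⟨hd₁, hd₂⟩ ⟨hc₁, hc₂⟩, hfc, hfd]; exact hr₀s₀
  refine ⟨c, d, hc₁.le, hcd, hd₂.le, by rw [hfc, hfd]; exact hr₀s₀, ?_⟩
  ext y; constructor
  · rintro ⟨x, hx, rfl⟩
    exact ⟨hanti ⟨hc₁.trans hx.1, hx.2.trans hd₂⟩ ⟨hd₁, hd₂⟩ hx.2,
      hanti ⟨hc₁, hc₂⟩ ⟨hc₁.trans hx.1, hx.2.trans hd₂⟩ hx.1⟩
  · rintro ⟨hy₁, hy₂⟩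
    rw [hfd] at hy₁; rw [hfc] at hy₂
    obtain ⟨x, hx₁, hx₂, rfl⟩ := hJ ⟨hpr₀.trans hy₁, hy₂.trans hs₀q⟩
    refine ⟨x, ⟨?_, ?_⟩, rfl⟩
    · rw [← hanti.lt_iff_gt ⟨hx₁, hx₂⟩ ⟨hc₁, hc₂⟩, hfc]; exact hy₂
    · rw [← hanti.lt_iff_gt ⟨hd₁, hd₂⟩ ⟨hx₁, hx₂⟩, hfd]; exact hy₁

omit [L.Structure M] in
/-- **Lemma 3, continuity half, increasing case** (van den Dries 1998, Ch. 3, (1.5): "But the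
topology is defined in terms of the order, hence `f` is continuous on `(c, d)`"): a strictly
increasing map of `(c, d)` onto an open interval is continuous at every point of `(c, d)`, in the
order sense `y₁ < f x < y₂ ⇒ y₁ < f < y₂` near `x`. Pure order theory. [cite: Dries1998, Ch. 3 (1.5) Lemma 3] -/
theorem ordCtsAt_of_image_eq_Ioo {c d u w : M} (hmono : StrictMonoOn f (Ioo c d))
    (himg : f '' Ioo c d = Ioo u w) {x : M} (hx : x ∈ Ioo c d) :
    ∀ y₁ y₂, y₁ < f x → f x < y₂ →
      ∃ x₁ x₂, x₁ < x ∧ x < x₂ ∧ ∀ x' ∈ Ioo x₁ x₂, y₁ < f x' ∧ f x' < y₂ := by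
  intro y₁ y₂ hy₁ hy₂
  have hfx : f x ∈ Ioo u w := himg ▸ mem_image_of_mem f hx
  obtain ⟨y₁', hy₁'₁, hy₁'₂⟩ := exists_between (max_lt hy₁ hfx.1)
  obtain ⟨y₂', hy₂'₁, hy₂'₂⟩ := exists_between (lt_min hy₂ hfx.2)
  have hy₁'I : y₁' ∈ Ioo u w := ⟨lt_of_le_of_lt (le_max_right _ _) hy₁'₁, hy₁'₂.trans hfx.2⟩
  have hy₂'I : y₂' ∈ Ioo u w := ⟨hfx.1.trans hy₂'₁, lt_of_lt_of_le hy₂'₂ (min_le_right _ _)⟩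
  obtain ⟨x₁, hx₁, hfx₁⟩ := (himg.symm ▸ hy₁'I : y₁' ∈ f '' Ioo c d)
  obtain ⟨x₂, hx₂, hfx₂⟩ := (himg.symm ▸ hy₂'I : y₂' ∈ f '' Ioo c d)
  have hx₁x : x₁ < x := by rw [← hmono.lt_iff_lt hx₁ hx, hfx₁]; exact hy₁'₂
  have hxx₂ : x < x₂ := by rw [← hmono.lt_iff_lt hx hx₂, hfx₂]; exact hy₂'₁
  refine ⟨x₁, x₂, hx₁x, hxx₂, fun x' hx' => ?_⟩
  have hx'I : x' ∈ Ioo c d := ⟨hx₁.1.trans hx'.1, hx'.2.trans hx₂.2⟩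
  constructor
  · calc y₁ ≤ max y₁ u := le_max_left _ _
      _ < y₁' := hy₁'₁
      _ = f x₁ := hfx₁.symm
      _ < f x' := hmono hx₁ hx'I hx'.1
  · calc f x' < f x₂ := hmono hx'I hx₂ hx'.2
      _ = y₂' := hfx₂
      _ < min y₂ w := hy₂'₂
      _ ≤ y₂ := min_le_left _ _

omit [L.Structure M] in
/-- **Lemma 3, continuity half, decreasing case** (van den Dries 1998, Ch. 3, (1.5), Lemma 3,
"the case that `f` is strictly decreasing goes the same way"): a strictly decreasing map of
`(c, d)` onto an open interval is continuous at every point of `(c, d)` in the order sense.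
[cite: Dries1998, Ch. 3 (1.5) Lemma 3] -/
theorem ordCtsAt_of_image_eq_Ioo_anti {c d u w : M} (hanti : StrictAntiOn f (Ioo c d))
    (himg : f '' Ioo c d = Ioo u w) {x : M} (hx : x ∈ Ioo c d) :
    ∀ y₁ y₂, y₁ < f x → f x < y₂ →
      ∃ x₁ x₂, x₁ < x ∧ x < x₂ ∧ ∀ x' ∈ Ioo x₁ x₂, y₁ < f x' ∧ f x' < y₂ := by
  intro y₁ y₂ hy₁ hy₂
  have hfx : f x ∈ Ioo u w := himg ▸ mem_image_of_mem f hx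
  obtain ⟨y₁', hy₁'₁, hy₁'₂⟩ := exists_between (max_lt hy₁ hfx.1)
  obtain ⟨y₂', hy₂'₁, hy₂'₂⟩ := exists_between (lt_min hy₂ hfx.2)
  have hy₁'I : y₁' ∈ Ioo u w := ⟨lt_of_le_of_lt (le_max_right _ _) hy₁'₁, hy₁'₂.trans hfx.2⟩
  have hy₂'I : y₂' ∈ Ioo u w := ⟨hfx.1.trans hy₂'₁, lt_of_lt_of_le hy₂'₂ (min_le_right _ _)⟩
  -- `x₁` is the preimage of the larger value `y₂'`, `x₂` that of `y₁'`
  obtain ⟨x₁, hx₁, hfx₁⟩ := (himg.symm ▸ hy₂'I : y₂' ∈ f '' Ioo c d)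
  obtain ⟨x₂, hx₂, hfx₂⟩ := (himg.symm ▸ hy₁'I : y₁' ∈ f '' Ioo c d)
  have hx₁x : x₁ < x := by rw [← hanti.lt_iff_gt hx hx₁, hfx₁]; exact hy₂'₁
  have hxx₂ : x < x₂ := by rw [← hanti.lt_iff_gt hx₂ hx, hfx₂]; exact hy₁'₂
  refine ⟨x₁, x₂, hx₁x, hxx₂, fun x' hx' => ?_⟩
  have hx'I : x' ∈ Ioo c d := ⟨hx₁.1.trans hx'.1, hx'.2.trans hx₂.2⟩
  constructor
  · calc y₁ ≤ max y₁ u := le_max_left _ _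
      _ < y₁' := hy₁'₁
      _ = f x₂ := hfx₂.symm
      _ < f x' := hanti hx'I hx₂ hx'.2
  · calc f x' < f x₁ := hanti hx₁ hx'I hx'.1
      _ = y₂' := hfx₁
      _ < min y₂ w := hy₂'₂
      _ ≤ y₂ := min_le_left _ _

/-! ### Local-to-global for a transitive definable relation -/

/-- **Patching** (van den Dries 1998, Ch. 3, (1.4), Cases 1–3, and the "easy case" `Φ₋₊` of the
proof of Lemma 2 in (1.5), in one statement).  Let `r` be a transitive definable relation (in
the applications `=`, `<` or `>`).  If at every point `x` of `(c, d)` the function `f` has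
`r (f y) (f x)` for all `y` in some interval `(c₁, x)` and `r (f x) (f y)` for all `y` in some
interval `(x, d₁)`, then `r (f x) (f y)` whenever `x < y` in `(c, d)`.  (Van den Dries argues with
`s := sup {x : … on [x₀, x)}`; here: the set of `z ∈ (x, d)` with `¬ r (f x) (f z)` is definable,
so if non-empty it has a greatest lower bound `m` in `M`, and the local hypothesis at `m` is
contradictory.) [cite: Dries1998, Ch. 3 (1.4)] -/
theorem rel_apply_of_local [NoMinOrder M] [NoMaxOrder M] (hO : L.IsOMinimal M) {r : M → M → Prop}
    (htrans : ∀ p q w, r p q → r q w → r p w)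
    (hlt : (univ : Set M).Definable L {v : Fin 2 → M | v 0 < v 1})
    (hr : (univ : Set M).Definable L {v : Fin 2 → M | r (v 0) (v 1)})
    (hf : (univ : Set M).Definable L {v : Fin 2 → M | v 1 = f (v 0)})
    {c d : M}
    (hloc : ∀ x ∈ Ioo c d, (∃ c₁, c₁ < x ∧ ∀ y ∈ Ioo c₁ x, r (f y) (f x)) ∧
      (∃ d₁, x < d₁ ∧ ∀ y ∈ Ioo x d₁, r (f x) (f y))) :
    ∀ x ∈ Ioo c d, ∀ y ∈ Ioo c d, x < y → r (f x) (f y) := by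
  intro x hx y hy hxy
  by_contra hcon
  -- the set of counterexamples to the right of `x`
  set S : Set M := {z | x < z ∧ z < d ∧ ¬ r (f x) (f z)} with hS
  have hSdef : IsFiniteUnionOfIntervals S :=
    isFiniteUnionOfIntervals_setOf hO
      (definable_setOf_and
        (definable_setOf_lt hlt (definableFun_const' _ x) (definableFun_proj 0))
        (definable_setOf_and
          (definable_setOf_lt hlt (definableFun_proj 0) (definableFun_const' _ d))
          (definable_setOf_not (definable_setOf_rel hr (definableFun_const' _ (f x))
            (definableFun_apply hf (definableFun_proj 0))))))
  have hyS : y ∈ S := ⟨hxy, hy.2, hcon⟩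
  obtain ⟨m, hm⟩ := hSdef.exists_isGLB ⟨y, hyS⟩ ⟨x, fun z hz => hz.1.le⟩
  have hxm : x ≤ m := hm.2 fun z hz => hz.1.le
  have hmy : m ≤ y := hm.1 hyS
  have hmd : m < d := hmy.trans_lt hy.2
  -- `m > x`: just right of `x` there are no counterexamples
  obtain ⟨-, d₁, hxd₁, hd₁⟩ := hloc x hx
  have hxm' : x < m := by
    have hlb : min d₁ d ∈ lowerBounds S := fun z hz =>
      le_of_not_gt fun hzlt => hz.2.2 (hd₁ z ⟨hz.1, lt_of_lt_of_le hzlt (min_le_left _ _)⟩)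
    exact (lt_min hxd₁ hx.2).trans_le (hm.2 hlb)
  have hmI : m ∈ Ioo c d := ⟨hx.1.trans hxm', hmd⟩
  obtain ⟨⟨c₂, hc₂m, hc₂⟩, d₂, hmd₂, hd₂⟩ := hloc m hmI
  -- a point `z` just left of `m`, right of `x`: not a counterexample, and `r (f z) (f m)`
  obtain ⟨z, hz₁, hz₂⟩ := exists_between (max_lt hc₂m hxm')
  have hzS : z ∉ S := fun hzS => (not_le.2 hz₂) (hm.1 hzS)
  have hxz : r (f x) (f z) := by
    by_contra h
    exact hzS ⟨lt_of_le_of_lt (le_max_right _ _) hz₁, hz₂.trans hmd, h⟩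
  have hxm_r : r (f x) (f m) :=
    htrans _ _ _ hxz (hc₂ z ⟨lt_of_le_of_lt (le_max_left _ _) hz₁, hz₂⟩)
  -- hence no counterexample in `[m, min d₂ d)`: contradiction with `m = inf S`
  have hlb : min d₂ d ∈ lowerBounds S := fun w hw => by
    refine le_of_not_gt fun hwlt => hw.2.2 ?_
    rcases (hm.1 hw).lt_or_eq with hmw | hmw
    · exact htrans _ _ _ hxm_r (hd₂ w ⟨hmw, lt_of_lt_of_le hwlt (min_le_left _ _)⟩)
    · rw [← hmw]; exact hxm_r
  exact (not_le.2 (lt_min hmd₂ hmd)) (hm.2 hlb)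

end Literature.ModelTheory.ExponentialFields
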